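import Mathlib
import Literature.Barriers.ValiantsHypothesis.CKRST20NaturalProofsExist
import Literature.Computability.AlgebraicComplexity.ArithCircuitProofs
import Summits.ValiantsHypothesis.ValiantsHypothesis.Theorems.BarrierLeverNaturalProofsSeparateVNPSignSliceParamGen
import Summits.ValiantsHypothesis.ValiantsHypothesis.Theorems.BarrierLeverNaturalProofsSeparateVNPSignSliceHitGen
import Summits.ValiantsHypothesis.ValiantsHypothesis.Theorems.BarrierLeverNaturalProofsSeparateVNPSignSliceBoolSumCoeff
import HarnessLib

/-!
# Item `BarrierLever.NaturalProofsSeparateVNP` (stmt-ValiantsHypothesis-18972), SIGN SLICE —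
# part 13: Raz parametrisation of Boolean sums — CKRST 2020 Lemma 20 (universal map for definable
# polynomials), discharged

The coefficient vector of a Boolean sum `boolSum g`, `g ∈ ℂ[x_1..x_n, w_1..w_m]` of degree and
size `≤ t`, is a fixed LINEAR image (CKRST Lemma 19, part 12) of the coefficient vector of `g`, which
in turn lies on the image of Raz's polynomial map (part 8, transported to the variable type
`Fin n ⊕ Fin m`). Hence:

* `VNPParam.exists_parametrization_boolSum` — for `n, t ≥ 1` and every `m, d`: a polynomial map
  `G : monomialsDegLE n d → ℂ[y_1..y_p]`, `p ≤ 9376 (n + m + 2t + 4)^21`, degrees `≤ 2t`, whose image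
  contains `coeff(boolSum g)` for every `g` of degree and size `≤ t`;
* `VNPParam.ckrst2020_lemma20_holds : CKRST2020_lemma20` — the named fact (v2 Lemma 20 = ECCC
  Lemma 5.7 = arXiv v4 Lemma 3.5: a universal polynomial map of `poly(s)` parameters and degree for
  the `s`-definable polynomials), with exponent `e = 100`.

References: [ChatterjeeKumarRamyaSaptharishiTengse2020] Lemma 5.6–5.7 (ECCC) = v2 Lemmas 19–20;
[Raz2010] Prop. 3.3.
-/

-- layout Summits/ValiantsHypothesis/ValiantsHypothesis forces the duplicated namespace component
set_option linter.dupNamespace false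

noncomputable section

namespace Summit.ValiantsHypothesis.ValiantsHypothesis.Theorems.BarrierLever.NaturalProofsSeparateVNP

open Literature.Barriers.ValiantsHypothesis Literature.Computability.AlgebraicComplexity MvPolynomial

namespace VNPParam

/-- The exponent vectors of degree `≤ t` on the variables `Fin n ⊕ Fin m`, as a finite type.
[cite: ChatterjeeKumarRamyaSaptharishiTengse2020, Def. 14] -/
@[reducible] def degFintype (n m t : ℕ) : Fintype {ν : Fin n ⊕ Fin m →₀ ℕ // ν.degree ≤ t} :=
  (Finsupp.finite_of_degree_le (σ := Fin n ⊕ Fin m) t).fintype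

/-- **Raz's parametrisation on the variables `x ⊕ w`** (part 8 transported along
`Fin n ⊕ Fin m ≃ Fin (n + m)`): a polynomial map with `p ≤ 9376 (n + m + 2t + 4)^21` parameters and
degrees `≤ 2t` through which the coefficient vector (on degree `≤ t`) of every `g ∈ ℂ[x ⊕ w]` of
degree and size `≤ t` factors. [cite: Raz2010, Prop. 3.3 (p. 158)] -/
theorem exists_parametrization_sumVars (n m t : ℕ) (hn : 1 ≤ n) (ht : 1 ≤ t) :
    ∃ (p : ℕ) (G : {ν : Fin n ⊕ Fin m →₀ ℕ // ν.degree ≤ t} → MvPolynomial (Fin p) ℂ),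
      p ≤ 9376 * (n + m + t + t + 4) ^ 21 ∧ (∀ ν, (G ν).totalDegree ≤ 2 * t) ∧
      ∀ g : MvPolynomial (Fin n ⊕ Fin m) ℂ, g.totalDegree ≤ t → complexity g ≤ t →
        ∃ y : Fin p → ℂ, ∀ ν, eval y (G ν) = coeff (ν : Fin n ⊕ Fin m →₀ ℕ) g := by
  let e : Fin n ⊕ Fin m ≃ Fin (n + m) := finSumFinEquiv
  obtain ⟨p, G₀, hp, hdeg, hG⟩ :=
    ParamGen.exists_parametrization_deg (n + m) t t (le_trans hn (Nat.le_add_right n m)) ht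
  refine ⟨p, fun ν => G₀ ⟨(ν : Fin n ⊕ Fin m →₀ ℕ).mapDomain e, by
      show Finsupp.degree _ ≤ t
      rw [Finsupp.degree_mapDomain]; exact ν.2⟩, hp, fun ν => hdeg _, ?_⟩
  intro g hgd hgc
  have hg' : rename e g ∈ vpSlice ℂ (n + m) t t := by
    refine ⟨(totalDegree_rename_le _ _).trans hgd, ?_⟩
    rw [complexity_rename_of_injective_holds e.injective g]; exact hgc
  obtain ⟨y, hy⟩ := hG _ hg'
  refine ⟨y, fun ν => ?_⟩
  rw [hy, coeff_rename_mapDomain e e.injective]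

/-- The linear map of CKRST Lemma 19, as weights: `c(μ, ν) = 2^{m - |supp ν_w|}` if `ν_x = μ`,
else `0`. [cite: ChatterjeeKumarRamyaSaptharishiTengse2020, Lemma 5.6 (ECCC)] -/
def weight {n m : ℕ} (μ : Fin n →₀ ℕ) (ν : Fin n ⊕ Fin m →₀ ℕ) : ℂ :=
  if (Finsupp.sumFinsuppEquivProdFinsupp ν).1 = μ then
    (2 : ℂ) ^ (m - (Finsupp.sumFinsuppEquivProdFinsupp ν).2.support.card) else 0

/-- CKRST Lemma 19 with the sum extended from `supp g` to all exponent vectors of degree `≤ t`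
(`deg g ≤ t`). [cite: ChatterjeeKumarRamyaSaptharishiTengse2020, Lemma 5.6 (ECCC)] -/
theorem coeff_boolSum_eq_sum {n m t : ℕ} (g : MvPolynomial (Fin n ⊕ Fin m) ℂ)
    (hgd : g.totalDegree ≤ t) (μ : Fin n →₀ ℕ) :
    letI := degFintype n m t
    coeff μ (boolSum g) =
      ∑ ν : {ν : Fin n ⊕ Fin m →₀ ℕ // ν.degree ≤ t}, weight μ ν.1 * coeff ν.1 g := by
  classical
  letI := degFintype n m t
  have h19 := BoolSumCoeff.ckrst2020_lemma19_holds ℂ n m g μ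
  rw [h19]
  -- the summand as a function of `ν`
  set F : (Fin n ⊕ Fin m →₀ ℕ) → ℂ := fun ν => weight μ ν * coeff ν g with hF
  have hsummand : ∀ ν, (if (Finsupp.sumFinsuppEquivProdFinsupp ν).1 = μ then
      (2 : ℂ) ^ (m - (Finsupp.sumFinsuppEquivProdFinsupp ν).2.support.card) * coeff ν g else 0) =
      F ν := by
    intro ν; simp only [hF, weight]; split_ifs <;> simp
  rw [Finset.sum_congr rfl fun ν _ => hsummand ν]
  -- extend the sum from `supp g` to all of degree `≤ t`
  let S : Finset (Fin n ⊕ Fin m →₀ ℕ) :=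
    (Finset.univ : Finset {ν : Fin n ⊕ Fin m →₀ ℕ // ν.degree ≤ t}).map
      (Function.Embedding.subtype _)
  have hsub : g.support ⊆ S := by
    intro ν hν
    simp only [S, Finset.mem_map, Finset.mem_univ, true_and, Function.Embedding.subtype_apply,
      Subtype.exists, exists_prop, exists_eq_right]
    calc ν.degree = ν.sum fun _ e => e := by rw [Finsupp.degree_apply]; rfl
      _ ≤ g.totalDegree := le_totalDegree hν
      _ ≤ t := hgd
  rw [Finset.sum_subset hsub (fun ν _ hν => by
    simp only [notMem_support_iff.mp hν, mul_zero])]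
  rw [Finset.sum_map]
  rfl

/-- **Raz parametrisation of Boolean sums.** For `n, t ≥ 1` and all `m, d`: a polynomial map
`G : monomialsDegLE n d → ℂ[y_1..y_p]` with `p ≤ 9376 (n + m + 2t + 4)^21` and degrees `≤ 2t` whose
image contains the coefficient vector of `boolSum g` for every `g ∈ ℂ[x ⊕ w]` (`|w| = m`) of degree
and size `≤ t`. [cite: ChatterjeeKumarRamyaSaptharishiTengse2020, Lemma 5.7 (ECCC) = Lemma 3.5 (arXiv v4)] -/
theorem exists_parametrization_boolSum (n m t d : ℕ) (hn : 1 ≤ n) (ht : 1 ≤ t) :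
    ∃ (p : ℕ) (G : monomialsDegLE n d → MvPolynomial (Fin p) ℂ),
      p ≤ 9376 * (n + m + t + t + 4) ^ 21 ∧ (∀ μ, (G μ).totalDegree ≤ 2 * t) ∧
      ∀ g : MvPolynomial (Fin n ⊕ Fin m) ℂ, g.totalDegree ≤ t → complexity g ≤ t →
        ∃ y : Fin p → ℂ, ∀ μ, eval y (G μ) = coeff (μ : Fin n →₀ ℕ) (boolSum g) := by
  classical
  letI := degFintype n m t
  obtain ⟨p, G, hp, hdeg, hG⟩ := exists_parametrization_sumVars n m t hn ht
  refine ⟨p, fun μ => ∑ ν : {ν : Fin n ⊕ Fin m →₀ ℕ // ν.degree ≤ t},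
    C (weight (μ : Fin n →₀ ℕ) ν.1) * G ν, hp, ?_, ?_⟩
  · intro μ
    refine totalDegree_finsetSum_le fun ν _ => (totalDegree_mul _ _).trans ?_
    rw [totalDegree_C, zero_add]; exact hdeg ν
  · intro g hgd hgc
    obtain ⟨y, hy⟩ := hG g hgd hgc
    refine ⟨y, fun μ => ?_⟩
    rw [coeff_boolSum_eq_sum g hgd]
    simp only [map_sum, map_mul, eval_C, hy]

/-! ### CKRST Lemma 20 (universal map for definable polynomials) -/

/-- `9376 (3s+4)^21 ≤ s^100` for `s ≥ 2`. [folklore] -/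
theorem params_le_pow (s : ℕ) (hs : 2 ≤ s) : 9376 * (s + (s - s) + s + s + 4) ^ 21 ≤ s ^ 100 := by
  have h0 : s + (s - s) + s + s + 4 = 3 * s + 4 := by omega
  rw [h0]
  have h1 : 3 * s + 4 ≤ s ^ 4 := by
    have : 8 ≤ s ^ 3 := by
      calc (8 : ℕ) = 2 ^ 3 := by norm_num
        _ ≤ s ^ 3 := Nat.pow_le_pow_left hs 3
    calc 3 * s + 4 ≤ 8 * s := by omega
      _ ≤ s ^ 3 * s := Nat.mul_le_mul_right s this
      _ = s ^ 4 := (pow_succ s 3).symm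
  have h2 : (3 * s + 4) ^ 21 ≤ s ^ 84 := by
    calc (3 * s + 4) ^ 21 ≤ (s ^ 4) ^ 21 := Nat.pow_le_pow_left h1 21
      _ = s ^ 84 := by rw [← pow_mul]
  have h3 : (9376 : ℕ) ≤ s ^ 14 := by
    calc (9376 : ℕ) ≤ 2 ^ 14 := by norm_num
      _ ≤ s ^ 14 := Nat.pow_le_pow_left hs 14
  calc 9376 * (3 * s + 4) ^ 21 ≤ s ^ 14 * s ^ 84 := Nat.mul_le_mul h3 h2
    _ = s ^ 98 := by rw [← pow_add]
    _ ≤ s ^ 100 := Nat.pow_le_pow_right (by omega) (by norm_num)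

/-- **CKRST 2020 Lemma 20 (ECCC Lemma 5.7, arXiv v4 Lemma 3.5) holds**: for `1 ≤ n ≤ s`, `s ≥ 2`,
a universal polynomial map with `≤ s^100` parameters and degrees `≤ s^100` through which the
coefficient vector (on `monomialsDegLE n d`) of every `s`-definable `f` factors.
[cite: ChatterjeeKumarRamyaSaptharishiTengse2020, Lemma 5.7 (ECCC) = v2 Lemma 20 = Lemma 3.5 (arXiv v4)] -/
theorem ckrst2020_lemma20_holds : CKRST2020_lemma20 := by
  refine ⟨100, fun n d s hn hns hs => ?_⟩
  obtain ⟨p, G, hp, hdeg, hG⟩ := exists_parametrization_boolSum n (s - n) s d hn (by omega)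
  have hpow := params_le_pow s hs
  have hns' : n + (s - n) = s + (s - s) := by omega
  refine ⟨p, G, ?_, fun μ => (hdeg μ).trans ?_, ?_⟩
  · rw [hns'] at hp; exact hp.trans hpow
  · calc 2 * s ≤ 3 * s + 4 := by omega
      _ ≤ 9376 * (s + (s - s) + s + s + 4) ^ 21 := by
          have h : s + (s - s) + s + s + 4 = 3 * s + 4 := by omega
          calc 3 * s + 4 = (3 * s + 4) ^ 1 := (pow_one _).symm
            _ ≤ (3 * s + 4) ^ 21 := Nat.pow_le_pow_right (by omega) (by norm_num)
            _ ≤ 9376 * (3 * s + 4) ^ 21 := Nat.le_mul_of_pos_left _ (by norm_num)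
            _ = 9376 * (s + (s - s) + s + s + 4) ^ 21 := by rw [h]
      _ ≤ s ^ 100 := hpow
  · rintro f ⟨-, -, g, hgd, hgc, rfl⟩
    obtain ⟨y, hy⟩ := hG g hgd hgc
    exact ⟨y, fun μ => by rw [hy, coeffVector_apply]⟩

end VNPParam

end Summit.ValiantsHypothesis.ValiantsHypothesis.Theorems.BarrierLever.NaturalProofsSeparateVNP
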